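import Summits.QuantumFields.QCD.Theses.QuarksAsStableAction

/-!
# `DiamagnetismImpliesStability` (route QuarksAsStableAction, item stmt-QuantumFields-9739)

Pure logic.  The sharp diamagnetic bound `CriticalLineDiamagnetism`
(`‖det D_AP[U,m]‖ ≤ exp (K − c₁·S_good(U) + C·N_bad(U)) · ‖det D_AP[𝟙,m]‖` with `c₁ > 0`)
implies the stability bound `WilsonQuarkStability`
(`‖det D_AP[U,m]‖ ≤ exp (K + c₂·S_good(U) + C·N_bad(U)) · ‖det D_AP[𝟙,m]‖` for SOME real `c₂`)
by choosing `c₂ := −c₁` and keeping `ε, δ, K, C, L₀`; the two exponents then agree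
(`K − c₁·S = K + (−c₁)·S`).  No property of the Wilson–Dirac operator is used.

Source of the reduction: the route thesis (planner's sketch `diamagnetismImpliesStability_holds`);
the mathematical content (integrate the fermions, keep a stability bound) is the Kennedy–Lieb
scheme [KennedyLieb1986], but nothing from it is needed here.
-/

namespace Summit.QuantumFields.QCD.Theorems

open Summit.QuantumFields.QCD.Theses.QuarksAsStableAction

/-- **Diamagnetism implies stability** (item stmt-QuantumFields-9739 of route
QuarksAsStableAction): `CriticalLineDiamagnetism → WilsonQuarkStability`.
Proof: from the witnesses `ε, δ, c₁, K, C, L₀` of the diamagnetic bound take the stability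
witnesses `ε, δ, K, c₂ := -c₁, C, L₀`; for every `L ≥ L₀`, `|m| ≤ ε` and gauge field `U` the
exponent `K + (-c₁)·S_good(U) + C·N_bad(U)` equals `K - c₁·S_good(U) + C·N_bad(U)`, so the
diamagnetic inequality is literally the stability inequality. -/
theorem diamagnetismImpliesStability_proof :
    Summit.QuantumFields.QCD.Theses.QuarksAsStableAction.DiamagnetismImpliesStability := by
  unfold DiamagnetismImpliesStability
  rintro ⟨ε, δ, c₁, K, C, hε, hδ, -, L₀, h⟩
  refine ⟨ε, δ, K, -c₁, C, hε, hδ, L₀, fun L _ hL => ?_⟩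
  intro apDet dfc m hm U
  rw [neg_mul, ← sub_eq_add_neg]
  exact h L hL m hm U

end Summit.QuantumFields.QCD.Theorems
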